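import Summits.BirchSwinnertonDyer.BirchSwinnertonDyer.Theorems.PrintX10bControlCokernelUniform
import Literature.NumberTheory.EllipticCurves.ZpExtensionEisensteinPinnedSelmerGlueProofs
import Literature.NumberTheory.EllipticCurves.ZpExtensionEisensteinDVRSetting
import HarnessLib

/-!
# The COMPACT-SIDE control inputs of the shared μ-crux socket for the curve, m-UNIFORM: `hcoker`, `hcoker_le`
# (`c = p^{n₁}`) and `hone` for Howard's control map `f_m : 𝔖_p(K_∞) → H¹_{F_𝔮}(K, T_{𝔮_m})`
# (helper for crux `PrintX10b.BeyondCarrierDepthX10b`, stmt-BirchSwinnertonDyer-23055, via the shared μ-crux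
# `MuInequalityCoherentPair` stmt-22642, `stub_controlGlue` of `Cruxes/MuInequalityCoherentPair/Lines/spec_witnesses.lean`)

Summits-side helper (`--supports stmt-BirchSwinnertonDyer-23055`); THEOREMS ONLY, no named fact, no `sorry`. Cell
`pub/bsd-print-x9`, seat `bsd-line-x10b-p1-w2` g9 (C7); companion of the generic
`Literature/NumberTheory/EllipticCurves/ZpExtensionEisensteinPinnedSelmerGlueProofs` (the glue `ι`, the honest
`S_m`-module, the cokernel lemma) and of `PrintX10bControlCokernelUniform` (p656163: ONE `e ∈ 𝔖` and ONE `n₁` with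
`f_m e ∉ T^{p^{n₁}} • H¹(K, T_{𝔮_m})` for all `m ≥ p^{n₁}`).

THE SETTING (all objects are the tree's; sign `κ⁻ = κ.unitTwist (-1)` of D1's `toEisensteinH1Linear`): `V/K` elliptic,
`𝔖 = D.S` (`LambdaAdicSelmerData`), the transition maps `t k := V.torsionGaloisModuleReduce p k` (= `P ↦ p • P`; by
`eq_torsionGaloisModuleReduce` EVERY `t` with the skeleton's pointwise `ht` IS this one, so the skeleton's `∀ t ht I`
collapses to `∀ I` after `obtain rfl := eq_torsionGaloisModuleReduce t ht`), a pin `I : EisensteinH1Data κ⁻ (E[p^k])_k t hm`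
of `H¹(K, T_{𝔮_m})`, the shifted Eisenstein tower `T♯ = κ⁻.eisensteinAdicTowerSucc …` (= `W.eisensteinTower κ⁻ hm`, the
`T` of `W.eisensteinDVRSetting κ⁻ hm …`, `eisensteinDVRSetting_T`), Howard's `F_𝔮 = κ⁻.eisensteinSelmerStructure … S Φ`
with `Φ = ordinaryFiltrationAt` (= `(St.t k).cond` at torsion level `k+1`, `eisensteinDVRSetting_t_cond`), the honest
module `H_m := ↥(I.selmerSubmodule F_𝔮 _)` (= `I.ordinarySelmer S Φ` as a set, where w2 g7's
`toEisensteinH1Linear_mem_ordinarySelmer[_of_isAnticyclotomic]` puts every `f_m s` — the hypothesis `hf` below) with ANY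
`S_m`-module structure compatible with `Λ` (e.g. `letI := (I.isTorsionBy_qm_submodule _).module`,
`haveI := I.isScalarTower_qm_submodule _`), and `f̂_m = (toEisensteinH1Linear …).codRestrict H_m hf`.

WHAT.
* `eq_torsionGaloisModuleReduce` — the `t`-collapse above.
* **`finite_coker_and_natCard_le_of_not_mem`** — `T♯.IsFreeRankOneOn (T♯.limitSelmer (k ↦ F_𝔮 (k+1))) x` (Howard
  Thm. 1.6.1 (a) = `Conclusion` (i) of the setting) and `f_m e ∉ T^j • H¹(K, T_{𝔮_m})`, `j < m` ⇒
  `Finite (H_m ⧸ range f̂_m) ∧ Nat.card (H_m ⧸ range f̂_m) ≤ p^j` (the generic `exists_bijective_toSpanSingleton_of_isFreeRankOneOn`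
  through the glue `ι = (I.proj (k+1))_k` — `injective_projSucc`, `mem_limitSelmer_succ_iff_mem_range`, `projSucc_smul` — then
  `finite_quotient_range_codRestrict_and_natCard_le`).
* `exists_ne_zero_and_smul_mem_span` (torsion quotient `𝔖/Λz` ⇒ `g • e ∈ Λz`, `g ≠ 0`) and
  **`toEisensteinH1Linear_ne_zero_of_smul_mem_span`** — under the same `hfree`, `f_m z ≠ 0` as soon as `[g] ≠ 0 ∈ S_m`.
* **`exists_forall_finite_coker_and_natCard_le`** — ∃ `n₁`, ∀ `m > p^{n₁}` ∀ `I S` ∀ compatible structure: `hf` + `hfree` ⇒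
  `hcoker ∧ hcoker_le ≤ p^{p^{n₁}}` (UNIFORM `c := p^{n₁}`), from p656163;
  **`exists_forall_finite_coker_and_natCard_le_and_ne_zero`** — the same ∧ `f_m z ≠ 0` for `m ≥ m₂`, given `z ≠ 0` with
  `𝔖/Λz` torsion (the letter's `stabilizedHeegnerModule D C = Λ z`, `Module.IsTorsion Λ (𝔖 ⧸ Λz)`): the inputs `hcoker`,
  `hcoker_le`, `hone` of `HeegnerMuPartStabilized.nonempty_specWitness_of_dvrConclusion_one` (p653022); its `hone_mem` is
  `projSucc_mem_limitSelmer_of_mem_ordinarySelmer (hf z)`, its `ι/hι_inj/hι_range/hι_smul` are the generic file's, its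
  `κ₁ := f̂_m z` has `ι κ₁ = (I.proj (k+1) (f_m z))_k = ctrlLevel … z` by `rfl`, and `hL` is `Submodule.map_span`.
HONEST FRAMING: this closes no stub by itself (the DISCRETE half `h/hker/hker_le` of `stub_controlGlue` is x10b-p2's
S1-DISCRETE; `hfree` is Howard Thm. 1.6.1 (a), cited via h161); no summit statement is proved; BSD is not proved by this.

References: B. Howard, Compositio Math. 140 (2004), Thm. 1.6.1 (a), §2.2 Lemma 2.2.7, Prop. 2.2.8, proof of
Thm. 2.2.10 (𝔮 = T^m + p); B. Mazur–K. Rubin, Mem. AMS 799 (2004), Prop. 5.3.14; J. Silverman, AEC (2009), III.§7.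
-/

set_option linter.dupNamespace false
set_option autoImplicit false

noncomputable section

open scoped TensorProduct ContRepresentation Classical

namespace Summit.BirchSwinnertonDyer.BirchSwinnertonDyer.Theorems.PrintX10bCompactControl

open WeierstrassCurve Literature.NumberTheory.EllipticCurves Literature.NumberTheory.GaloisRepresentations IsDedekindDomain
open Literature.NumberTheory.EllipticCurves.ZpExtension Literature.NumberTheory.GaloisCohomology.Howard2004
open scoped NumberField

variable {K : Type} [Field K] [NumberField K] {V : WeierstrassCurve K} [V.IsElliptic] {p : ℕ} [hp : Fact p.Prime]
  {κ : ZpExtension K p} {γ : Field.absoluteGaloisGroup K}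

omit [NumberField K] [V.IsElliptic] hp in
/-- **The transition datum is `P ↦ p • P`.** Any family `t k : E[p^{k+1}] →ⁱL E[p^k]` agreeing pointwise with
`geomTorsionReduce` (the binder `ht` of `toEisensteinH1Linear` and of the μ-crux skeleton) IS the tree's
`torsionGaloisModuleReduce` — so every pin `I : EisensteinH1Data … t hm` is a pin over D1's transition maps, and the
skeleton's `∀ t ht I` collapses to `∀ I` (use `obtain rfl := eq_torsionGaloisModuleReduce t ht`).
[cite: SilvermanAEC2009, III.§7 (T_p E = lim E[p^k] along [p])] -/
theorem eq_torsionGaloisModuleReduce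
    (t : ∀ k, (V.torsionGaloisModule ((p : ℤ) ^ (k + 1))).toContRepresentation →ⁱL
      (V.torsionGaloisModule ((p : ℤ) ^ k)).toContRepresentation)
    (ht : ∀ k (P : geomTorsion V ((p : ℤ) ^ (k + 1))), t k P = V.geomTorsionReduce p k P) :
    t = fun k ↦ V.torsionGaloisModuleReduce p k :=
  funext fun k ↦ ContIntertwiningMap.ext (ContinuousLinearMap.ext fun P ↦ ht k P)

/-- **`hcoker`, `hcoker_le` for Howard's control map `f_m : 𝔖 → H¹_{F_𝔮}(K, T_𝔮)`, from ONE non-divisible value.**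
Let `I` pin `H¹(K, T_𝔮)` (`𝔮 = T^m + p`, sign `κ⁻ = κ.unitTwist (-1)`), `H := I.selmerSubmodule F_𝔮 _ = H¹_{F_𝔮}(K, T_𝔮)`
with any `Λ`-compatible `S_m`-structure, `f = toEisensteinH1Linear` landing in `H` (`hf`, e.g.
`toEisensteinH1Linear_mem_ordinarySelmer_of_isAnticyclotomic`), and let `lim_k H¹_{F_𝔮}(K, T_𝔮/p^{k+1})` be free of
rank one over `S_m` (`hfree`, Howard Thm. 1.6.1 (a) = `Conclusion` (i) on the shifted Eisenstein tower). If
`f e ∉ T^j • H¹(K, T_𝔮)` with `j < m`, then the cokernel of `f̂ : 𝔖 → H` is finite of order `≤ p^j`.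
[cite: Howard2004HeegnerKolyvagin, Thm. 1.6.1 (a), Prop. 2.2.8 and proof of Thm. 2.2.10 (𝔮 = T^m + p)]
[cite: MazurRubinMemoirs2004, Prop. 5.3.14] -/
theorem finite_coker_and_natCard_le_of_not_mem (D : V.LambdaAdicSelmerData κ γ) {m : ℕ} (hm : 1 ≤ m)
    [IsDomain (IwasawaAlgebra p ⧸
      Ideal.span {(PowerSeries.X ^ m + PowerSeries.C (p : ℤ_[p]) : IwasawaAlgebra p)})]
    [IsDiscreteValuationRing (IwasawaAlgebra p ⧸
      Ideal.span {(PowerSeries.X ^ m + PowerSeries.C (p : ℤ_[p]) : IwasawaAlgebra p)})]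
    (I : ZpExtension.EisensteinH1Data (κ.unitTwist (-1)) (fun k ↦ V.torsionGaloisModule ((p : ℤ) ^ k))
      (fun k ↦ V.torsionGaloisModuleReduce p k) hm)
    (hγ : κ.IsTopGenerator γ) (hE : ∀ P : V.toAffine.Point, p • P = 0 → P = 0)
    (S : Finset (HeightOneSpectrum (𝓞 K)))
    [Module (IwasawaAlgebra p ⧸
      Ideal.span {(PowerSeries.X ^ m + PowerSeries.C (p : ℤ_[p]) : IwasawaAlgebra p)})
      ↥(I.selmerSubmodule
        ((κ.unitTwist (-1)).eisensteinSelmerStructure (fun k ↦ V.torsionGaloisModule ((p : ℤ) ^ k))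
          (fun k ↦ V.torsionGaloisModuleReduce p k) hm S
          (fun v _ ↦ V.ordinaryFiltrationAt v (fun k ↦ V.torsionGaloisModuleReduce p k) (fun _ _ ↦ rfl)))
        (fun k c x hx ↦ (κ.unitTwist (-1)).map_eisensteinTwistSMulHom_mem_selmerGroup
          (fun k ↦ V.torsionGaloisModule ((p : ℤ) ^ k)) (fun k ↦ V.torsionGaloisModuleReduce p k) hm S
          (fun v _ ↦ V.ordinaryFiltrationAt v (fun k ↦ V.torsionGaloisModuleReduce p k) (fun _ _ ↦ rfl)) k c x hx))]
    [IsScalarTower (IwasawaAlgebra p) (IwasawaAlgebra p ⧸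
      Ideal.span {(PowerSeries.X ^ m + PowerSeries.C (p : ℤ_[p]) : IwasawaAlgebra p)})
      ↥(I.selmerSubmodule
        ((κ.unitTwist (-1)).eisensteinSelmerStructure (fun k ↦ V.torsionGaloisModule ((p : ℤ) ^ k))
          (fun k ↦ V.torsionGaloisModuleReduce p k) hm S
          (fun v _ ↦ V.ordinaryFiltrationAt v (fun k ↦ V.torsionGaloisModuleReduce p k) (fun _ _ ↦ rfl)))
        (fun k c x hx ↦ (κ.unitTwist (-1)).map_eisensteinTwistSMulHom_mem_selmerGroup
          (fun k ↦ V.torsionGaloisModule ((p : ℤ) ^ k)) (fun k ↦ V.torsionGaloisModuleReduce p k) hm S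
          (fun v _ ↦ V.ordinaryFiltrationAt v (fun k ↦ V.torsionGaloisModuleReduce p k) (fun _ _ ↦ rfl)) k c x hx))]
    (hf : ∀ s : D.S, D.toEisensteinH1Linear hm (fun k ↦ V.torsionGaloisModuleReduce p k) (fun _ _ ↦ rfl) I hγ hE s ∈
      I.ordinarySelmer S
        (fun v _ ↦ V.ordinaryFiltrationAt v (fun k ↦ V.torsionGaloisModuleReduce p k) (fun _ _ ↦ rfl)))
    (x : ∀ k, galoisCohomology (((κ.unitTwist (-1)).eisensteinAdicTowerSucc
      (fun k ↦ V.torsionGaloisModule ((p : ℤ) ^ k)) (fun k ↦ V.torsionGaloisModuleReduce p k) hm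
      (fun k ↦ V.torsionGaloisModuleReduce_surjective p k)).ρ k) 1)
    (hfree : ((κ.unitTwist (-1)).eisensteinAdicTowerSucc
      (fun k ↦ V.torsionGaloisModule ((p : ℤ) ^ k)) (fun k ↦ V.torsionGaloisModuleReduce p k) hm
      (fun k ↦ V.torsionGaloisModuleReduce_surjective p k)).IsFreeRankOneOn
        (((κ.unitTwist (-1)).eisensteinAdicTowerSucc
          (fun k ↦ V.torsionGaloisModule ((p : ℤ) ^ k)) (fun k ↦ V.torsionGaloisModuleReduce p k) hm
          (fun k ↦ V.torsionGaloisModuleReduce_surjective p k)).limitSelmer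
          (fun k ↦ (κ.unitTwist (-1)).eisensteinSelmerStructure (fun k ↦ V.torsionGaloisModule ((p : ℤ) ^ k))
            (fun k ↦ V.torsionGaloisModuleReduce p k) hm S
            (fun v _ ↦ V.ordinaryFiltrationAt v (fun k ↦ V.torsionGaloisModuleReduce p k) (fun _ _ ↦ rfl))
            (k + 1))) x)
    (e : D.S) {j : ℕ} (hjm : j < m)
    (he : D.toEisensteinH1Linear hm (fun k ↦ V.torsionGaloisModuleReduce p k) (fun _ _ ↦ rfl) I hγ hE e ∉
      (Ideal.span {(PowerSeries.X : IwasawaAlgebra p) ^ j} • ⊤ : Submodule (IwasawaAlgebra p) I.H)) :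
    Finite (↥(I.selmerSubmodule
        ((κ.unitTwist (-1)).eisensteinSelmerStructure (fun k ↦ V.torsionGaloisModule ((p : ℤ) ^ k))
          (fun k ↦ V.torsionGaloisModuleReduce p k) hm S
          (fun v _ ↦ V.ordinaryFiltrationAt v (fun k ↦ V.torsionGaloisModuleReduce p k) (fun _ _ ↦ rfl)))
        (fun k c x hx ↦ (κ.unitTwist (-1)).map_eisensteinTwistSMulHom_mem_selmerGroup
          (fun k ↦ V.torsionGaloisModule ((p : ℤ) ^ k)) (fun k ↦ V.torsionGaloisModuleReduce p k) hm S
          (fun v _ ↦ V.ordinaryFiltrationAt v (fun k ↦ V.torsionGaloisModuleReduce p k) (fun _ _ ↦ rfl)) k c x hx)) ⧸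
      LinearMap.range ((D.toEisensteinH1Linear hm (fun k ↦ V.torsionGaloisModuleReduce p k) (fun _ _ ↦ rfl) I hγ
        hE).codRestrict _ hf)) ∧
    Nat.card (↥(I.selmerSubmodule
        ((κ.unitTwist (-1)).eisensteinSelmerStructure (fun k ↦ V.torsionGaloisModule ((p : ℤ) ^ k))
          (fun k ↦ V.torsionGaloisModuleReduce p k) hm S
          (fun v _ ↦ V.ordinaryFiltrationAt v (fun k ↦ V.torsionGaloisModuleReduce p k) (fun _ _ ↦ rfl)))
        (fun k c x hx ↦ (κ.unitTwist (-1)).map_eisensteinTwistSMulHom_mem_selmerGroup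
          (fun k ↦ V.torsionGaloisModule ((p : ℤ) ^ k)) (fun k ↦ V.torsionGaloisModuleReduce p k) hm S
          (fun v _ ↦ V.ordinaryFiltrationAt v (fun k ↦ V.torsionGaloisModuleReduce p k) (fun _ _ ↦ rfl)) k c x hx)) ⧸
      LinearMap.range ((D.toEisensteinH1Linear hm (fun k ↦ V.torsionGaloisModuleReduce p k) (fun _ _ ↦ rfl) I hγ
        hE).codRestrict _ hf)) ≤ p ^ j := by
  -- the honest generator from Thm. 1.6.1 (a) through the glue `ι`
  obtain ⟨x₀, -, hx₀⟩ := IwasawaAlgebra.exists_bijective_toSpanSingleton_of_isFreeRankOneOn _ _ x hfree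
    ((AddMonoidHom.pi (fun k ↦ I.proj (k + 1))).comp (Submodule.subtype _).toAddMonoidHom)
    ((I.injective_projSucc (fun k ↦ V.torsionGaloisModuleReduce_surjective p k)).comp Subtype.val_injective)
    (fun y ↦ I.mem_limitSelmer_succ_iff_mem_range (fun k ↦ V.torsionGaloisModuleReduce_surjective p k) S _ y)
    (fun r y ↦ I.projSucc_smul (fun k ↦ V.torsionGaloisModuleReduce_surjective p k) _ r y)
  exact IwasawaAlgebra.finite_quotient_range_codRestrict_and_natCard_le p hm _ x₀ hx₀ _ hf e hjm he

/-- A torsion quotient `𝔖/Λz` gives, for every `e ∈ 𝔖`, a NON-ZERO `g ∈ Λ` with `g • e ∈ Λ z`. [cite: Howard2004HeegnerKolyvagin, proof of Thm. 2.2.10 (𝔖 has Λ-rank one)] -/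
theorem exists_ne_zero_and_smul_mem_span {S : Type*} [AddCommGroup S] [Module (IwasawaAlgebra p) S] (z : S)
    (htor : Module.IsTorsion (IwasawaAlgebra p) (S ⧸ (IwasawaAlgebra p) ∙ z)) (e : S) :
    ∃ g : IwasawaAlgebra p, g ≠ 0 ∧ g • e ∈ (IwasawaAlgebra p) ∙ z := by
  obtain ⟨⟨g, hg⟩, hge⟩ := @htor (Submodule.Quotient.mk e)
  refine ⟨g, nonZeroDivisors.ne_zero hg, ?_⟩
  rw [← Submodule.Quotient.mk_eq_zero, Submodule.Quotient.mk_smul]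
  exact hge

/-- **`hone`: the control value `f_m z` is non-zero.** In the situation of `finite_coker_and_natCard_le_of_not_mem`
(`H¹_{F_𝔮}` free of rank one, `f e ∉ T^j • H¹(K, T_𝔮)`), if `g • e ∈ Λ z` with `[g] ≠ 0 ∈ S_m` then
`f z = toEisensteinH1Linear … z ≠ 0` — so the bottom class `(proj_{k+1} (f z))_k` of the μ-crux skeleton is non-zero
for every `m` with `q_m ∤ g` (`IwasawaAlgebra.exists_forall_mk_ne_zero`: all `m ≫ 0`).
[cite: Howard2004HeegnerKolyvagin, proof of Thm. 2.2.10 (κ₁ generates an infinite S_𝔮-submodule for almost all 𝔮)] -/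
theorem toEisensteinH1Linear_ne_zero_of_smul_mem_span (D : V.LambdaAdicSelmerData κ γ) {m : ℕ} (hm : 1 ≤ m)
    [IsDomain (IwasawaAlgebra p ⧸
      Ideal.span {(PowerSeries.X ^ m + PowerSeries.C (p : ℤ_[p]) : IwasawaAlgebra p)})]
    [IsDiscreteValuationRing (IwasawaAlgebra p ⧸
      Ideal.span {(PowerSeries.X ^ m + PowerSeries.C (p : ℤ_[p]) : IwasawaAlgebra p)})]
    (I : ZpExtension.EisensteinH1Data (κ.unitTwist (-1)) (fun k ↦ V.torsionGaloisModule ((p : ℤ) ^ k))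
      (fun k ↦ V.torsionGaloisModuleReduce p k) hm)
    (hγ : κ.IsTopGenerator γ) (hE : ∀ P : V.toAffine.Point, p • P = 0 → P = 0)
    (S : Finset (HeightOneSpectrum (𝓞 K)))
    [Module (IwasawaAlgebra p ⧸
      Ideal.span {(PowerSeries.X ^ m + PowerSeries.C (p : ℤ_[p]) : IwasawaAlgebra p)})
      ↥(I.selmerSubmodule
        ((κ.unitTwist (-1)).eisensteinSelmerStructure (fun k ↦ V.torsionGaloisModule ((p : ℤ) ^ k))
          (fun k ↦ V.torsionGaloisModuleReduce p k) hm S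
          (fun v _ ↦ V.ordinaryFiltrationAt v (fun k ↦ V.torsionGaloisModuleReduce p k) (fun _ _ ↦ rfl)))
        (fun k c x hx ↦ (κ.unitTwist (-1)).map_eisensteinTwistSMulHom_mem_selmerGroup
          (fun k ↦ V.torsionGaloisModule ((p : ℤ) ^ k)) (fun k ↦ V.torsionGaloisModuleReduce p k) hm S
          (fun v _ ↦ V.ordinaryFiltrationAt v (fun k ↦ V.torsionGaloisModuleReduce p k) (fun _ _ ↦ rfl)) k c x hx))]
    [IsScalarTower (IwasawaAlgebra p) (IwasawaAlgebra p ⧸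
      Ideal.span {(PowerSeries.X ^ m + PowerSeries.C (p : ℤ_[p]) : IwasawaAlgebra p)})
      ↥(I.selmerSubmodule
        ((κ.unitTwist (-1)).eisensteinSelmerStructure (fun k ↦ V.torsionGaloisModule ((p : ℤ) ^ k))
          (fun k ↦ V.torsionGaloisModuleReduce p k) hm S
          (fun v _ ↦ V.ordinaryFiltrationAt v (fun k ↦ V.torsionGaloisModuleReduce p k) (fun _ _ ↦ rfl)))
        (fun k c x hx ↦ (κ.unitTwist (-1)).map_eisensteinTwistSMulHom_mem_selmerGroup
          (fun k ↦ V.torsionGaloisModule ((p : ℤ) ^ k)) (fun k ↦ V.torsionGaloisModuleReduce p k) hm S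
          (fun v _ ↦ V.ordinaryFiltrationAt v (fun k ↦ V.torsionGaloisModuleReduce p k) (fun _ _ ↦ rfl)) k c x hx))]
    (hf : ∀ s : D.S, D.toEisensteinH1Linear hm (fun k ↦ V.torsionGaloisModuleReduce p k) (fun _ _ ↦ rfl) I hγ hE s ∈
      I.ordinarySelmer S
        (fun v _ ↦ V.ordinaryFiltrationAt v (fun k ↦ V.torsionGaloisModuleReduce p k) (fun _ _ ↦ rfl)))
    (x : ∀ k, galoisCohomology (((κ.unitTwist (-1)).eisensteinAdicTowerSucc
      (fun k ↦ V.torsionGaloisModule ((p : ℤ) ^ k)) (fun k ↦ V.torsionGaloisModuleReduce p k) hm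
      (fun k ↦ V.torsionGaloisModuleReduce_surjective p k)).ρ k) 1)
    (hfree : ((κ.unitTwist (-1)).eisensteinAdicTowerSucc
      (fun k ↦ V.torsionGaloisModule ((p : ℤ) ^ k)) (fun k ↦ V.torsionGaloisModuleReduce p k) hm
      (fun k ↦ V.torsionGaloisModuleReduce_surjective p k)).IsFreeRankOneOn
        (((κ.unitTwist (-1)).eisensteinAdicTowerSucc
          (fun k ↦ V.torsionGaloisModule ((p : ℤ) ^ k)) (fun k ↦ V.torsionGaloisModuleReduce p k) hm
          (fun k ↦ V.torsionGaloisModuleReduce_surjective p k)).limitSelmer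
          (fun k ↦ (κ.unitTwist (-1)).eisensteinSelmerStructure (fun k ↦ V.torsionGaloisModule ((p : ℤ) ^ k))
            (fun k ↦ V.torsionGaloisModuleReduce p k) hm S
            (fun v _ ↦ V.ordinaryFiltrationAt v (fun k ↦ V.torsionGaloisModuleReduce p k) (fun _ _ ↦ rfl))
            (k + 1))) x)
    (e : D.S) {j : ℕ}
    (he : D.toEisensteinH1Linear hm (fun k ↦ V.torsionGaloisModuleReduce p k) (fun _ _ ↦ rfl) I hγ hE e ∉
      (Ideal.span {(PowerSeries.X : IwasawaAlgebra p) ^ j} • ⊤ : Submodule (IwasawaAlgebra p) I.H))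
    (z : D.S) (g : IwasawaAlgebra p)
    (hg : Ideal.Quotient.mk
      (Ideal.span {(PowerSeries.X ^ m + PowerSeries.C (p : ℤ_[p]) : IwasawaAlgebra p)}) g ≠ 0)
    (hge : g • e ∈ (IwasawaAlgebra p) ∙ z) :
    D.toEisensteinH1Linear hm (fun k ↦ V.torsionGaloisModuleReduce p k) (fun _ _ ↦ rfl) I hγ hE z ≠ 0 := by
  obtain ⟨x₀, -, hx₀⟩ := IwasawaAlgebra.exists_bijective_toSpanSingleton_of_isFreeRankOneOn _ _ x hfree
    ((AddMonoidHom.pi (fun k ↦ I.proj (k + 1))).comp (Submodule.subtype _).toAddMonoidHom)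
    ((I.injective_projSucc (fun k ↦ V.torsionGaloisModuleReduce_surjective p k)).comp Subtype.val_injective)
    (fun y ↦ I.mem_limitSelmer_succ_iff_mem_range (fun k ↦ V.torsionGaloisModuleReduce_surjective p k) S _ y)
    (fun r y ↦ I.projSucc_smul (fun k ↦ V.torsionGaloisModuleReduce_surjective p k) _ r y)
  exact IwasawaAlgebra.apply_ne_zero_of_smul_mem_span p _ x₀ hx₀ _ hf e he z g hg hge

/-- **The m-UNIFORM compact-side control inputs of the μ-crux socket, packaged.** For `E(K)[p] = 0`, `γ` a topological
generator and `𝔖 = 𝔖_p(K_∞)` finitely generated and non-zero there is ONE `n₁` (from ONE `e ∈ 𝔖 ∖ p𝔖`) such that for EVERY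
`m > p^{n₁}`, every pin `I` of `H¹(K, T_{𝔮_m})`, every `S` and every compatible `S_m`-structure on
`H_m = H¹_{F_𝔮}(K, T_{𝔮_m})`: whenever `f_m(𝔖) ⊆ H_m` (`hf`) and `lim_k H¹_{F_𝔮}(K, T_{𝔮_m}/p^{k+1})` is free of rank one
(`hfree` = Howard Thm. 1.6.1 (a)), the cokernel of `f̂_m : 𝔖 → H_m` is finite of order `≤ p^{p^{n₁}}` — `hcoker` and
`hcoker_le` of `nonempty_specWitness_of_dvrConclusion_one` with `c := p^{n₁}` INDEPENDENT of `m`.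
[cite: Howard2004HeegnerKolyvagin, Thm. 1.6.1 (a), Prop. 2.2.8 and proof of Thm. 2.2.10 (𝔮 = T^m + p)]
[cite: MazurRubinMemoirs2004, Prop. 5.3.14] -/
theorem exists_forall_finite_coker_and_natCard_le (D : V.LambdaAdicSelmerData κ γ)
    [Module.Finite (IwasawaAlgebra p) D.S] (hγ : κ.IsTopGenerator γ)
    (hE : ∀ P : V.toAffine.Point, p • P = 0 → P = 0) (hS0 : ∃ s : D.S, s ≠ 0) :
    ∃ n₁ : ℕ, ∀ {m : ℕ} (hm : 1 ≤ m),
      letI := IwasawaAlgebra.isDomain_quotient_X_pow_add_C p hm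
      letI := IwasawaAlgebra.isDiscreteValuationRing_quotient_X_pow_add_C p hm
      ∀ (I : ZpExtension.EisensteinH1Data (κ.unitTwist (-1)) (fun k ↦ V.torsionGaloisModule ((p : ℤ) ^ k))
        (fun k ↦ V.torsionGaloisModuleReduce p k) hm)
      (S : Finset (HeightOneSpectrum (𝓞 K)))
      [Module (IwasawaAlgebra p ⧸
        Ideal.span {(PowerSeries.X ^ m + PowerSeries.C (p : ℤ_[p]) : IwasawaAlgebra p)})
        ↥(I.selmerSubmodule
          ((κ.unitTwist (-1)).eisensteinSelmerStructure (fun k ↦ V.torsionGaloisModule ((p : ℤ) ^ k))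
            (fun k ↦ V.torsionGaloisModuleReduce p k) hm S
            (fun v _ ↦ V.ordinaryFiltrationAt v (fun k ↦ V.torsionGaloisModuleReduce p k) (fun _ _ ↦ rfl)))
          (fun k c x hx ↦ (κ.unitTwist (-1)).map_eisensteinTwistSMulHom_mem_selmerGroup
            (fun k ↦ V.torsionGaloisModule ((p : ℤ) ^ k)) (fun k ↦ V.torsionGaloisModuleReduce p k) hm S
            (fun v _ ↦ V.ordinaryFiltrationAt v (fun k ↦ V.torsionGaloisModuleReduce p k) (fun _ _ ↦ rfl)) k c x hx))]
      [IsScalarTower (IwasawaAlgebra p) (IwasawaAlgebra p ⧸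
        Ideal.span {(PowerSeries.X ^ m + PowerSeries.C (p : ℤ_[p]) : IwasawaAlgebra p)})
        ↥(I.selmerSubmodule
          ((κ.unitTwist (-1)).eisensteinSelmerStructure (fun k ↦ V.torsionGaloisModule ((p : ℤ) ^ k))
            (fun k ↦ V.torsionGaloisModuleReduce p k) hm S
            (fun v _ ↦ V.ordinaryFiltrationAt v (fun k ↦ V.torsionGaloisModuleReduce p k) (fun _ _ ↦ rfl)))
          (fun k c x hx ↦ (κ.unitTwist (-1)).map_eisensteinTwistSMulHom_mem_selmerGroup
            (fun k ↦ V.torsionGaloisModule ((p : ℤ) ^ k)) (fun k ↦ V.torsionGaloisModuleReduce p k) hm S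
            (fun v _ ↦ V.ordinaryFiltrationAt v (fun k ↦ V.torsionGaloisModuleReduce p k) (fun _ _ ↦ rfl)) k c x hx))]
      (hf : ∀ s : D.S, D.toEisensteinH1Linear hm (fun k ↦ V.torsionGaloisModuleReduce p k) (fun _ _ ↦ rfl) I hγ hE s ∈
        I.ordinarySelmer S
          (fun v _ ↦ V.ordinaryFiltrationAt v (fun k ↦ V.torsionGaloisModuleReduce p k) (fun _ _ ↦ rfl)))
      (x : ∀ k, galoisCohomology (((κ.unitTwist (-1)).eisensteinAdicTowerSucc
        (fun k ↦ V.torsionGaloisModule ((p : ℤ) ^ k)) (fun k ↦ V.torsionGaloisModuleReduce p k) hm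
        (fun k ↦ V.torsionGaloisModuleReduce_surjective p k)).ρ k) 1),
      ((κ.unitTwist (-1)).eisensteinAdicTowerSucc
        (fun k ↦ V.torsionGaloisModule ((p : ℤ) ^ k)) (fun k ↦ V.torsionGaloisModuleReduce p k) hm
        (fun k ↦ V.torsionGaloisModuleReduce_surjective p k)).IsFreeRankOneOn
          (((κ.unitTwist (-1)).eisensteinAdicTowerSucc
            (fun k ↦ V.torsionGaloisModule ((p : ℤ) ^ k)) (fun k ↦ V.torsionGaloisModuleReduce p k) hm
            (fun k ↦ V.torsionGaloisModuleReduce_surjective p k)).limitSelmer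
            (fun k ↦ (κ.unitTwist (-1)).eisensteinSelmerStructure (fun k ↦ V.torsionGaloisModule ((p : ℤ) ^ k))
              (fun k ↦ V.torsionGaloisModuleReduce p k) hm S
              (fun v _ ↦ V.ordinaryFiltrationAt v (fun k ↦ V.torsionGaloisModuleReduce p k) (fun _ _ ↦ rfl))
              (k + 1))) x →
      p ^ n₁ < m →
      Finite (↥(I.selmerSubmodule
          ((κ.unitTwist (-1)).eisensteinSelmerStructure (fun k ↦ V.torsionGaloisModule ((p : ℤ) ^ k))
            (fun k ↦ V.torsionGaloisModuleReduce p k) hm S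
            (fun v _ ↦ V.ordinaryFiltrationAt v (fun k ↦ V.torsionGaloisModuleReduce p k) (fun _ _ ↦ rfl)))
          (fun k c x hx ↦ (κ.unitTwist (-1)).map_eisensteinTwistSMulHom_mem_selmerGroup
            (fun k ↦ V.torsionGaloisModule ((p : ℤ) ^ k)) (fun k ↦ V.torsionGaloisModuleReduce p k) hm S
            (fun v _ ↦ V.ordinaryFiltrationAt v (fun k ↦ V.torsionGaloisModuleReduce p k) (fun _ _ ↦ rfl)) k c x hx)) ⧸
        LinearMap.range ((D.toEisensteinH1Linear hm (fun k ↦ V.torsionGaloisModuleReduce p k) (fun _ _ ↦ rfl) I hγ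
          hE).codRestrict _ hf)) ∧
      Nat.card (↥(I.selmerSubmodule
          ((κ.unitTwist (-1)).eisensteinSelmerStructure (fun k ↦ V.torsionGaloisModule ((p : ℤ) ^ k))
            (fun k ↦ V.torsionGaloisModuleReduce p k) hm S
            (fun v _ ↦ V.ordinaryFiltrationAt v (fun k ↦ V.torsionGaloisModuleReduce p k) (fun _ _ ↦ rfl)))
          (fun k c x hx ↦ (κ.unitTwist (-1)).map_eisensteinTwistSMulHom_mem_selmerGroup
            (fun k ↦ V.torsionGaloisModule ((p : ℤ) ^ k)) (fun k ↦ V.torsionGaloisModuleReduce p k) hm S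
            (fun v _ ↦ V.ordinaryFiltrationAt v (fun k ↦ V.torsionGaloisModuleReduce p k) (fun _ _ ↦ rfl)) k c x hx)) ⧸
        LinearMap.range ((D.toEisensteinH1Linear hm (fun k ↦ V.torsionGaloisModuleReduce p k) (fun _ _ ↦ rfl) I hγ
          hE).codRestrict _ hf)) ≤ p ^ (p ^ n₁) := by
  obtain ⟨e, n₁, hen₁⟩ := PrintX10bModPDivision.exists_forall_toEisensteinH1Linear_not_mem_X_pow_smul_top D hγ hE hS0
  refine ⟨n₁, fun hm I S _ _ hf x hfree hn₁m ↦ ?_⟩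
  haveI := IwasawaAlgebra.isDomain_quotient_X_pow_add_C p hm
  haveI := IwasawaAlgebra.isDiscreteValuationRing_quotient_X_pow_add_C p hm
  exact finite_coker_and_natCard_le_of_not_mem D hm I hγ hE S hf x hfree e hn₁m
    (hen₁ hm _ (fun _ _ ↦ rfl) I hn₁m.le)


/-- **The compact-side inputs of the μ-crux socket, packaged with the non-vanishing of the bottom class.** For
`E(K)[p] = 0`, `γ` a topological generator, `𝔖 = 𝔖_p(K_∞)` finitely generated and `z ∈ 𝔖` non-zero with `𝔖/Λz`
torsion (the letter's `stabilizedHeegnerModule D C = Λ z`, `Module.IsTorsion Λ (𝔖 ⧸ Λ z)`), there are `n₁, m₂` such that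
for EVERY `m` with `p^{n₁} < m` and `m₂ ≤ m`, every pin `I`, every `S`, every compatible `S_m`-structure on `H_m`:
`f_m(𝔖) ⊆ H_m` and `lim_k H¹_{F_𝔮}(K, T_{𝔮_m}/p^{k+1})` free of rank one imply
`Finite (H_m ⧸ range f̂_m)`, `Nat.card (H_m ⧸ range f̂_m) ≤ p^{p^{n₁}}` AND `f_m z ≠ 0` — `hcoker`, `hcoker_le` (with
`c := p^{n₁}`) and `hone` of `nonempty_specWitness_of_dvrConclusion_one`, all three UNIFORM in `m`.
[cite: Howard2004HeegnerKolyvagin, Thm. 1.6.1 (a), Prop. 2.2.8 and proof of Thm. 2.2.10 (𝔮 = T^m + p; κ₁ generates an infinite submodule for almost all 𝔮)]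
[cite: MazurRubinMemoirs2004, Prop. 5.3.14] -/
theorem exists_forall_finite_coker_and_natCard_le_and_ne_zero (D : V.LambdaAdicSelmerData κ γ)
    [Module.Finite (IwasawaAlgebra p) D.S] (hγ : κ.IsTopGenerator γ)
    (hE : ∀ P : V.toAffine.Point, p • P = 0 → P = 0) (z : D.S) (hz : z ≠ 0)
    (htor : Module.IsTorsion (IwasawaAlgebra p) (D.S ⧸ (IwasawaAlgebra p) ∙ z)) :
    ∃ n₁ m₂ : ℕ, ∀ {m : ℕ} (hm : 1 ≤ m),
      letI := IwasawaAlgebra.isDomain_quotient_X_pow_add_C p hm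
      letI := IwasawaAlgebra.isDiscreteValuationRing_quotient_X_pow_add_C p hm
      ∀ (I : ZpExtension.EisensteinH1Data (κ.unitTwist (-1)) (fun k ↦ V.torsionGaloisModule ((p : ℤ) ^ k))
        (fun k ↦ V.torsionGaloisModuleReduce p k) hm)
      (S : Finset (HeightOneSpectrum (𝓞 K)))
      [Module (IwasawaAlgebra p ⧸
        Ideal.span {(PowerSeries.X ^ m + PowerSeries.C (p : ℤ_[p]) : IwasawaAlgebra p)})
        ↥(I.selmerSubmodule
          ((κ.unitTwist (-1)).eisensteinSelmerStructure (fun k ↦ V.torsionGaloisModule ((p : ℤ) ^ k))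
            (fun k ↦ V.torsionGaloisModuleReduce p k) hm S
            (fun v _ ↦ V.ordinaryFiltrationAt v (fun k ↦ V.torsionGaloisModuleReduce p k) (fun _ _ ↦ rfl)))
          (fun k c x hx ↦ (κ.unitTwist (-1)).map_eisensteinTwistSMulHom_mem_selmerGroup
            (fun k ↦ V.torsionGaloisModule ((p : ℤ) ^ k)) (fun k ↦ V.torsionGaloisModuleReduce p k) hm S
            (fun v _ ↦ V.ordinaryFiltrationAt v (fun k ↦ V.torsionGaloisModuleReduce p k) (fun _ _ ↦ rfl)) k c x hx))]
      [IsScalarTower (IwasawaAlgebra p) (IwasawaAlgebra p ⧸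
        Ideal.span {(PowerSeries.X ^ m + PowerSeries.C (p : ℤ_[p]) : IwasawaAlgebra p)})
        ↥(I.selmerSubmodule
          ((κ.unitTwist (-1)).eisensteinSelmerStructure (fun k ↦ V.torsionGaloisModule ((p : ℤ) ^ k))
            (fun k ↦ V.torsionGaloisModuleReduce p k) hm S
            (fun v _ ↦ V.ordinaryFiltrationAt v (fun k ↦ V.torsionGaloisModuleReduce p k) (fun _ _ ↦ rfl)))
          (fun k c x hx ↦ (κ.unitTwist (-1)).map_eisensteinTwistSMulHom_mem_selmerGroup
            (fun k ↦ V.torsionGaloisModule ((p : ℤ) ^ k)) (fun k ↦ V.torsionGaloisModuleReduce p k) hm S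
            (fun v _ ↦ V.ordinaryFiltrationAt v (fun k ↦ V.torsionGaloisModuleReduce p k) (fun _ _ ↦ rfl)) k c x hx))]
      (hf : ∀ s : D.S, D.toEisensteinH1Linear hm (fun k ↦ V.torsionGaloisModuleReduce p k) (fun _ _ ↦ rfl) I hγ hE s ∈
        I.ordinarySelmer S
          (fun v _ ↦ V.ordinaryFiltrationAt v (fun k ↦ V.torsionGaloisModuleReduce p k) (fun _ _ ↦ rfl)))
      (x : ∀ k, galoisCohomology (((κ.unitTwist (-1)).eisensteinAdicTowerSucc
        (fun k ↦ V.torsionGaloisModule ((p : ℤ) ^ k)) (fun k ↦ V.torsionGaloisModuleReduce p k) hm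
        (fun k ↦ V.torsionGaloisModuleReduce_surjective p k)).ρ k) 1),
      ((κ.unitTwist (-1)).eisensteinAdicTowerSucc
        (fun k ↦ V.torsionGaloisModule ((p : ℤ) ^ k)) (fun k ↦ V.torsionGaloisModuleReduce p k) hm
        (fun k ↦ V.torsionGaloisModuleReduce_surjective p k)).IsFreeRankOneOn
          (((κ.unitTwist (-1)).eisensteinAdicTowerSucc
            (fun k ↦ V.torsionGaloisModule ((p : ℤ) ^ k)) (fun k ↦ V.torsionGaloisModuleReduce p k) hm
            (fun k ↦ V.torsionGaloisModuleReduce_surjective p k)).limitSelmer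
            (fun k ↦ (κ.unitTwist (-1)).eisensteinSelmerStructure (fun k ↦ V.torsionGaloisModule ((p : ℤ) ^ k))
              (fun k ↦ V.torsionGaloisModuleReduce p k) hm S
              (fun v _ ↦ V.ordinaryFiltrationAt v (fun k ↦ V.torsionGaloisModuleReduce p k) (fun _ _ ↦ rfl))
              (k + 1))) x →
      p ^ n₁ < m → m₂ ≤ m →
      (Finite (↥(I.selmerSubmodule
          ((κ.unitTwist (-1)).eisensteinSelmerStructure (fun k ↦ V.torsionGaloisModule ((p : ℤ) ^ k))
            (fun k ↦ V.torsionGaloisModuleReduce p k) hm S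
            (fun v _ ↦ V.ordinaryFiltrationAt v (fun k ↦ V.torsionGaloisModuleReduce p k) (fun _ _ ↦ rfl)))
          (fun k c x hx ↦ (κ.unitTwist (-1)).map_eisensteinTwistSMulHom_mem_selmerGroup
            (fun k ↦ V.torsionGaloisModule ((p : ℤ) ^ k)) (fun k ↦ V.torsionGaloisModuleReduce p k) hm S
            (fun v _ ↦ V.ordinaryFiltrationAt v (fun k ↦ V.torsionGaloisModuleReduce p k) (fun _ _ ↦ rfl)) k c x hx)) ⧸
        LinearMap.range ((D.toEisensteinH1Linear hm (fun k ↦ V.torsionGaloisModuleReduce p k) (fun _ _ ↦ rfl) I hγ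
          hE).codRestrict _ hf)) ∧
      Nat.card (↥(I.selmerSubmodule
          ((κ.unitTwist (-1)).eisensteinSelmerStructure (fun k ↦ V.torsionGaloisModule ((p : ℤ) ^ k))
            (fun k ↦ V.torsionGaloisModuleReduce p k) hm S
            (fun v _ ↦ V.ordinaryFiltrationAt v (fun k ↦ V.torsionGaloisModuleReduce p k) (fun _ _ ↦ rfl)))
          (fun k c x hx ↦ (κ.unitTwist (-1)).map_eisensteinTwistSMulHom_mem_selmerGroup
            (fun k ↦ V.torsionGaloisModule ((p : ℤ) ^ k)) (fun k ↦ V.torsionGaloisModuleReduce p k) hm S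
            (fun v _ ↦ V.ordinaryFiltrationAt v (fun k ↦ V.torsionGaloisModuleReduce p k) (fun _ _ ↦ rfl)) k c x hx)) ⧸
        LinearMap.range ((D.toEisensteinH1Linear hm (fun k ↦ V.torsionGaloisModuleReduce p k) (fun _ _ ↦ rfl) I hγ
          hE).codRestrict _ hf)) ≤ p ^ (p ^ n₁)) ∧
      D.toEisensteinH1Linear hm (fun k ↦ V.torsionGaloisModuleReduce p k) (fun _ _ ↦ rfl) I hγ hE z ≠ 0 := by
  obtain ⟨e, n₁, hen₁⟩ :=
    PrintX10bModPDivision.exists_forall_toEisensteinH1Linear_not_mem_X_pow_smul_top D hγ hE ⟨z, hz⟩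
  obtain ⟨g, hg0, hge⟩ := exists_ne_zero_and_smul_mem_span z htor e
  obtain ⟨m₂, hm₂⟩ := IwasawaAlgebra.exists_forall_mk_ne_zero p hg0
  refine ⟨n₁, m₂, fun hm I S _ _ hf x hfree hn₁m hm₂m ↦ ?_⟩
  haveI := IwasawaAlgebra.isDomain_quotient_X_pow_add_C p hm
  haveI := IwasawaAlgebra.isDiscreteValuationRing_quotient_X_pow_add_C p hm
  have he := hen₁ hm _ (fun _ _ ↦ rfl) I hn₁m.le
  exact ⟨finite_coker_and_natCard_le_of_not_mem D hm I hγ hE S hf x hfree e hn₁m he,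
    toEisensteinH1Linear_ne_zero_of_smul_mem_span D hm I hγ hE S hf x hfree e he z g (hm₂ _ hm₂m) hge⟩

end Summit.BirchSwinnertonDyer.BirchSwinnertonDyer.Theorems.PrintX10bCompactControl

end
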